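import Mathlib
import HarnessLib

/-!
# Density approximation — `stub_densityApproximation` (stub GLUE)
of line `swap-odd-threshold-rigidity` (crux `EmbeddedDrudeMourre.MourreDissolution`,
item stmt-AtomisticToContinuum-12594; helper file, `--supports`)

Registered stub GLUE of the checked skeleton of line `swap-odd-threshold-rigidity`, in the
skeleton's stub namespace `Summit.AtomisticToContinuum.FouriersLaw.Theorems.MourreDissolution`.

Statement (pure measure theory on `ℝ`). Let `m` be a finite Borel measure on `ℝ`, `δ > 0`,
`W = (-δ, δ)`. Suppose that for every `ε > 0` the measure splits as `m = m₁ + m₂`, where `m₁` has a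
continuous nonnegative density `ρ₁` on `W` with respect to Lebesgue measure and `m₂` puts mass
`≤ ε·r` on every open interval of radius `r`. Then `m` itself has a continuous nonnegative density
on `W`.

Proof.
* Choose the data along `εₙ = 1/(n+1)`: `m = μ₁ⁿ + μ₂ⁿ` with window densities `ρₙ` of `μ₁ⁿ`.
* Key pointwise estimate (`densApprox_pointwise_le`): `ρₙ x ≤ ρₖ x + εₖ/2` on `W`. Otherwise, by
  continuity, `ρₙ > ρₖ + εₖ/2 + η` on a small interval `I = (x−r, x+r) ⊆ W`; integrating,
  `μ₁ⁿ(I) ≥ μ₁ᵏ(I) + (εₖ/2 + η)·2r`, while `μ₁ⁿ(I) ≤ m(I) = μ₁ᵏ(I) + μ₂ᵏ(I) ≤ μ₁ᵏ(I) + εₖ r`,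
  a contradiction (all masses are finite).
* Put `ρ x = supₙ ρₙ x`; then `ρₙ ≤ ρ ≤ ρₙ + εₙ/2` on `W`, so `ρₙ → ρ` uniformly on `W` and `ρ` is
  continuous and nonnegative on `W`.
* Measure identity (`densApprox_measure_eq`): for measurable `A`, with `B = A ∩ W`,
  `m(B) = μ₁ⁿ(B) + μ₂ⁿ(B) ≤ ∫_B ρ + εₙ δ` and `∫_B ρ ≤ ∫_B ρₙ + (εₙ/2)·vol(B) ≤ m(B) + εₙ δ`;
  let `n → ∞`.
-/

noncomputable section

namespace Summit.AtomisticToContinuum.FouriersLaw.Theorems.MourreDissolution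

open MeasureTheory Filter Set Function Topology
open scoped ENNReal NNReal Topology

/-- If `μ` restricted to `W` is Lebesgue-on-`W` with density `f`, then `μ A = ∫⁻_A f` for every
measurable `A ⊆ W`. [folklore] -/
theorem densApprox_apply_eq_setLIntegral {μ : Measure ℝ} {W A : Set ℝ} {f : ℝ → ℝ≥0∞}
    (h : μ.restrict W = (volume.restrict W).withDensity f) (hA : MeasurableSet A)
    (hAW : A ⊆ W) : μ A = ∫⁻ x in A, f x := by
  have h' : μ.restrict W A = (volume.restrict W).withDensity f A := by rw [h]
  rwa [Measure.restrict_apply hA, withDensity_apply _ hA, Measure.restrict_restrict hA,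
    Set.inter_eq_self_of_subset_left hAW] at h'

/-- Key local estimate: two continuous window densities `f`, `g` of parts `μ₁`, `ν₁` of the same
finite measure `m = μ₁ + μ₂ = ν₁ + ν₂`, where the remainder `ν₂` puts mass `≤ ε r` on every open
interval of radius `r`, satisfy `f ≤ g + ε/2` pointwise on the open window. [folklore] -/
theorem densApprox_pointwise_le {m μ₁ μ₂ ν₁ ν₂ : Measure ℝ} [IsFiniteMeasure m] {δ ε : ℝ}
    {f g : ℝ → ℝ} (hμ : m = μ₁ + μ₂) (hν : m = ν₁ + ν₂)
    (hf : ContinuousOn f (Ioo (-δ) δ)) (hg : ContinuousOn g (Ioo (-δ) δ))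
    (hg0 : ∀ x ∈ Ioo (-δ) δ, 0 ≤ g x)
    (hμ₁ : μ₁.restrict (Ioo (-δ) δ) =
      (volume.restrict (Ioo (-δ) δ)).withDensity fun x => ENNReal.ofReal (f x))
    (hν₁ : ν₁.restrict (Ioo (-δ) δ) =
      (volume.restrict (Ioo (-δ) δ)).withDensity fun x => ENNReal.ofReal (g x))
    (hν₂ : ∀ E r : ℝ, 0 < r → ν₂ (Ioo (E - r) (E + r)) ≤ ENNReal.ofReal (ε * r))
    (hε : 0 ≤ ε) {x : ℝ} (hx : x ∈ Ioo (-δ) δ) : f x ≤ g x + ε / 2 := by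
  by_contra hlt
  push Not at hlt
  obtain ⟨η, hη0, hη⟩ : ∃ η : ℝ, 0 < η ∧ ε / 2 + η < f x - g x :=
    ⟨(f x - g x - ε / 2) / 2, by linarith, by linarith⟩
  have hW : Ioo (-δ) δ ∈ 𝓝 x := isOpen_Ioo.mem_nhds hx
  have hcont : ContinuousAt (fun y => f y - g y) x := (hf.sub hg).continuousAt hW
  have h1 : ∀ᶠ y in 𝓝 x, y ∈ Ioo (-δ) δ := hW
  have h2 : ∀ᶠ y in 𝓝 x, ε / 2 + η < f y - g y := hcont.eventually_const_lt hη
  obtain ⟨r, hr0, hr⟩ := Metric.eventually_nhds_iff_ball.1 (h1.and h2)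
  rw [Real.ball_eq_Ioo] at hr
  have hImeas : MeasurableSet (Ioo (x - r) (x + r)) := measurableSet_Ioo
  have hIW : Ioo (x - r) (x + r) ⊆ Ioo (-δ) δ := fun y hy => (hr y hy).1
  have hfI : μ₁ (Ioo (x - r) (x + r)) = ∫⁻ y in Ioo (x - r) (x + r), ENNReal.ofReal (f y) :=
    densApprox_apply_eq_setLIntegral hμ₁ hImeas hIW
  have hgI : ν₁ (Ioo (x - r) (x + r)) = ∫⁻ y in Ioo (x - r) (x + r), ENNReal.ofReal (g y) :=
    densApprox_apply_eq_setLIntegral hν₁ hImeas hIW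
  have hfin : ν₁ (Ioo (x - r) (x + r)) ≠ ∞ := by
    have hle : ν₁ (Ioo (x - r) (x + r)) ≤ m (Ioo (x - r) (x + r)) := by
      rw [hν, Measure.add_apply]; exact le_self_add
    exact (hle.trans_lt (measure_lt_top m _)).ne
  have hvol : volume (Ioo (x - r) (x + r)) = ENNReal.ofReal (2 * r) := by
    rw [Real.volume_Ioo]; congr 1; ring
  have hub : ∫⁻ y in Ioo (x - r) (x + r), ENNReal.ofReal (f y)
      ≤ ν₁ (Ioo (x - r) (x + r)) + ENNReal.ofReal (ε * r) := by
    calc ∫⁻ y in Ioo (x - r) (x + r), ENNReal.ofReal (f y) = μ₁ (Ioo (x - r) (x + r)) := hfI.symm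
      _ ≤ m (Ioo (x - r) (x + r)) := by rw [hμ, Measure.add_apply]; exact le_self_add
      _ = ν₁ (Ioo (x - r) (x + r)) + ν₂ (Ioo (x - r) (x + r)) := by rw [hν, Measure.add_apply]
      _ ≤ ν₁ (Ioo (x - r) (x + r)) + ENNReal.ofReal (ε * r) :=
          add_le_add le_rfl (hν₂ x r hr0)
  have hlb : ν₁ (Ioo (x - r) (x + r)) + ENNReal.ofReal ((ε / 2 + η) * (2 * r))
      ≤ ∫⁻ y in Ioo (x - r) (x + r), ENNReal.ofReal (f y) := by
    calc ν₁ (Ioo (x - r) (x + r)) + ENNReal.ofReal ((ε / 2 + η) * (2 * r))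
          = (∫⁻ y in Ioo (x - r) (x + r), ENNReal.ofReal (g y))
            + ENNReal.ofReal (ε / 2 + η) * volume (Ioo (x - r) (x + r)) := by
            rw [hgI, hvol, ENNReal.ofReal_mul (show (0 : ℝ) ≤ ε / 2 + η by positivity)]
      _ = ∫⁻ y in Ioo (x - r) (x + r), (ENNReal.ofReal (g y) + ENNReal.ofReal (ε / 2 + η)) := by
            rw [lintegral_add_right _ measurable_const, setLIntegral_const]
      _ ≤ ∫⁻ y in Ioo (x - r) (x + r), ENNReal.ofReal (f y) := by
            refine setLIntegral_mono' hImeas fun y hy => ?_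
            rw [← ENNReal.ofReal_add (hg0 y (hIW hy)) (by positivity)]
            exact ENNReal.ofReal_le_ofReal (by linarith [(hr y hy).2])
  have hfinal := (ENNReal.add_le_add_iff_left hfin).1 (hlb.trans hub)
  rw [ENNReal.ofReal_le_ofReal_iff (by positivity)] at hfinal
  nlinarith [mul_pos hη0 hr0]

/-- Squeezing the measure identity: if `m = μ₁ⁿ + μ₂ⁿ` for all `n`, with `μ₁ⁿ` of window density
`ρₙ`, `μ₂ⁿ` of mass `≤ δ/(n+1)` on the window, and `ρₙ ≤ ρ ≤ ρₙ + 1/(2(n+1))` on the window, then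
`m` has window density `ρ`. [folklore] -/
theorem densApprox_measure_eq {m : Measure ℝ} {δ : ℝ} {ρ : ℝ → ℝ}
    {μ₁ μ₂ : ℕ → Measure ℝ} {ρs : ℕ → ℝ → ℝ} (hsum : ∀ n, m = μ₁ n + μ₂ n)
    (hdens : ∀ n, (μ₁ n).restrict (Ioo (-δ) δ) =
      (volume.restrict (Ioo (-δ) δ)).withDensity fun x => ENNReal.ofReal (ρs n x))
    (hslab : ∀ n, μ₂ n (Ioo (-δ) δ) ≤ ENNReal.ofReal (1 / ((n : ℝ) + 1) * δ))
    (hnonneg : ∀ n, ∀ x ∈ Ioo (-δ) δ, 0 ≤ ρs n x)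
    (hle : ∀ n, ∀ x ∈ Ioo (-δ) δ, ρs n x ≤ ρ x)
    (hge : ∀ n, ∀ x ∈ Ioo (-δ) δ, ρ x ≤ ρs n x + 1 / ((n : ℝ) + 1) / 2) :
    m.restrict (Ioo (-δ) δ) =
      (volume.restrict (Ioo (-δ) δ)).withDensity fun x => ENNReal.ofReal (ρ x) := by
  ext A hA
  rw [Measure.restrict_apply hA, withDensity_apply _ hA, Measure.restrict_restrict hA]
  have hBm : MeasurableSet (A ∩ Ioo (-δ) δ) := hA.inter measurableSet_Ioo
  have hBW : A ∩ Ioo (-δ) δ ⊆ Ioo (-δ) δ := Set.inter_subset_right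
  have hvolB : volume (A ∩ Ioo (-δ) δ) ≤ ENNReal.ofReal (2 * δ) := by
    calc volume (A ∩ Ioo (-δ) δ) ≤ volume (Ioo (-δ) δ) := measure_mono hBW
      _ = ENNReal.ofReal (2 * δ) := by rw [Real.volume_Ioo]; congr 1; ring
  -- the error sequence `δ/(n+1) → 0`
  have hc0 : Tendsto (fun n : ℕ => ENNReal.ofReal (1 / ((n : ℝ) + 1) * δ)) atTop (𝓝 0) := by
    have h := (tendsto_one_div_add_atTop_nhds_zero_nat (𝕜 := ℝ)).mul_const δ
    rw [zero_mul] at h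
    have h' := ENNReal.tendsto_ofReal h
    rwa [ENNReal.ofReal_zero] at h'
  have h1 : ∀ n, μ₁ n (A ∩ Ioo (-δ) δ) = ∫⁻ x in A ∩ Ioo (-δ) δ, ENNReal.ofReal (ρs n x) :=
    fun n => densApprox_apply_eq_setLIntegral (hdens n) hBm hBW
  have hup : ∀ n : ℕ, m (A ∩ Ioo (-δ) δ)
      ≤ (∫⁻ x in A ∩ Ioo (-δ) δ, ENNReal.ofReal (ρ x)) + ENNReal.ofReal (1 / ((n : ℝ) + 1) * δ) :=
    fun n => by
    calc m (A ∩ Ioo (-δ) δ) = μ₁ n (A ∩ Ioo (-δ) δ) + μ₂ n (A ∩ Ioo (-δ) δ) := by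
          rw [hsum n, Measure.add_apply]
      _ ≤ (∫⁻ x in A ∩ Ioo (-δ) δ, ENNReal.ofReal (ρ x))
          + ENNReal.ofReal (1 / ((n : ℝ) + 1) * δ) := by
          rw [h1 n]
          exact add_le_add
            (setLIntegral_mono' hBm fun x hx => ENNReal.ofReal_le_ofReal (hle n x (hBW hx)))
            ((measure_mono hBW).trans (hslab n))
  have hdown : ∀ n : ℕ, (∫⁻ x in A ∩ Ioo (-δ) δ, ENNReal.ofReal (ρ x))
      ≤ m (A ∩ Ioo (-δ) δ) + ENNReal.ofReal (1 / ((n : ℝ) + 1) * δ) := fun n => by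
    have hμle : μ₁ n (A ∩ Ioo (-δ) δ) ≤ m (A ∩ Ioo (-δ) δ) := by
      rw [hsum n, Measure.add_apply]; exact le_self_add
    calc (∫⁻ x in A ∩ Ioo (-δ) δ, ENNReal.ofReal (ρ x))
          ≤ ∫⁻ x in A ∩ Ioo (-δ) δ,
              (ENNReal.ofReal (ρs n x) + ENNReal.ofReal (1 / ((n : ℝ) + 1) / 2)) := by
            refine setLIntegral_mono' hBm fun x hx => ?_
            rw [← ENNReal.ofReal_add (hnonneg n x (hBW hx)) (by positivity)]
            exact ENNReal.ofReal_le_ofReal (hge n x (hBW hx))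
      _ = μ₁ n (A ∩ Ioo (-δ) δ)
            + ENNReal.ofReal (1 / ((n : ℝ) + 1) / 2) * volume (A ∩ Ioo (-δ) δ) := by
            rw [lintegral_add_right _ measurable_const, setLIntegral_const, h1 n]
      _ ≤ m (A ∩ Ioo (-δ) δ) + ENNReal.ofReal (1 / ((n : ℝ) + 1) / 2) * ENNReal.ofReal (2 * δ) := by
            gcongr
      _ = m (A ∩ Ioo (-δ) δ) + ENNReal.ofReal (1 / ((n : ℝ) + 1) * δ) := by
            rw [← ENNReal.ofReal_mul (show (0 : ℝ) ≤ 1 / ((n : ℝ) + 1) / 2 by positivity)]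
            congr 2
            ring
  have hlim1 : Tendsto (fun n : ℕ => (∫⁻ x in A ∩ Ioo (-δ) δ, ENNReal.ofReal (ρ x))
      + ENNReal.ofReal (1 / ((n : ℝ) + 1) * δ)) atTop
      (𝓝 ((∫⁻ x in A ∩ Ioo (-δ) δ, ENNReal.ofReal (ρ x)) + 0)) := tendsto_const_nhds.add hc0
  have hlim2 : Tendsto (fun n : ℕ => m (A ∩ Ioo (-δ) δ) + ENNReal.ofReal (1 / ((n : ℝ) + 1) * δ))
      atTop (𝓝 (m (A ∩ Ioo (-δ) δ) + 0)) := tendsto_const_nhds.add hc0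
  rw [add_zero] at hlim1 hlim2
  exact le_antisymm (ge_of_tendsto' hlim1 hup) (ge_of_tendsto' hlim2 hdown)

/-- **Stub GLUE** (`stub_densityApproximation`) of line `swap-odd-threshold-rigidity`: a finite
measure on `ℝ` which, for every `ε > 0`, splits on the window `(-δ, δ)` into a part with a
continuous nonnegative Lebesgue density plus a part of mass `≤ ε r` on every radius-`r` interval,
has itself a continuous nonnegative Lebesgue density on the window. [folklore] -/
theorem stub_densityApproximation :
    ∀ (m : MeasureTheory.Measure ℝ) (δ : ℝ), MeasureTheory.IsFiniteMeasure m → 0 < δ →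
      (∀ ε : ℝ, 0 < ε → ∃ m₁ m₂ : MeasureTheory.Measure ℝ, m = m₁ + m₂ ∧
        (∃ ρ₁ : ℝ → ℝ, ContinuousOn ρ₁ (Set.Ioo (-δ) δ) ∧ (∀ x ∈ Set.Ioo (-δ) δ, 0 ≤ ρ₁ x) ∧
          m₁.restrict (Set.Ioo (-δ) δ) =
            (volume.restrict (Set.Ioo (-δ) δ)).withDensity (fun x => ENNReal.ofReal (ρ₁ x))) ∧
        (∀ E r : ℝ, 0 < r → m₂ (Set.Ioo (E - r) (E + r)) ≤ ENNReal.ofReal (ε * r))) →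
      ∃ ρ : ℝ → ℝ, ContinuousOn ρ (Set.Ioo (-δ) δ) ∧ (∀ x ∈ Set.Ioo (-δ) δ, 0 ≤ ρ x) ∧
        m.restrict (Set.Ioo (-δ) δ) =
          (volume.restrict (Set.Ioo (-δ) δ)).withDensity (fun x => ENNReal.ofReal (ρ x)) := by
  intro m δ hm hδ H
  -- data along `εₙ = 1/(n+1)`
  have H' : ∀ n : ℕ, ∃ (m₁ m₂ : Measure ℝ) (ρ₁ : ℝ → ℝ), m = m₁ + m₂ ∧
      ContinuousOn ρ₁ (Ioo (-δ) δ) ∧ (∀ x ∈ Ioo (-δ) δ, 0 ≤ ρ₁ x) ∧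
      m₁.restrict (Ioo (-δ) δ) =
        (volume.restrict (Ioo (-δ) δ)).withDensity (fun x => ENNReal.ofReal (ρ₁ x)) ∧
      ∀ E r : ℝ, 0 < r → m₂ (Ioo (E - r) (E + r)) ≤ ENNReal.ofReal (1 / ((n : ℝ) + 1) * r) := by
    intro n
    obtain ⟨m₁, m₂, h1, ⟨ρ₁, h2, h3, h4⟩, h5⟩ := H (1 / ((n : ℝ) + 1)) (by positivity)
    exact ⟨m₁, m₂, ρ₁, h1, h2, h3, h4, h5⟩
  choose μ₁ μ₂ ρs hsum hcont hnonneg hdens hslab using H'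
  have hεpos : ∀ n : ℕ, (0 : ℝ) < 1 / ((n : ℝ) + 1) := fun n => by positivity
  -- key two-sided estimate
  have key : ∀ n k, ∀ x ∈ Ioo (-δ) δ, ρs n x ≤ ρs k x + 1 / ((k : ℝ) + 1) / 2 :=
    fun n k x hx => densApprox_pointwise_le (hsum n) (hsum k) (hcont n) (hcont k) (hnonneg k)
      (hdens n) (hdens k) (hslab k) (hεpos k).le hx
  -- the limit density `ρ x = ⨆ k, ρs k x`
  have hbdd : ∀ x ∈ Ioo (-δ) δ, BddAbove (Set.range fun k => ρs k x) := fun x hx => by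
    refine ⟨ρs 0 x + 1 / (((0 : ℕ) : ℝ) + 1) / 2, ?_⟩
    rintro _ ⟨n, rfl⟩
    exact key n 0 x hx
  have hle : ∀ n, ∀ x ∈ Ioo (-δ) δ, ρs n x ≤ ⨆ k, ρs k x := fun n x hx => le_ciSup (hbdd x hx) n
  have hge : ∀ n, ∀ x ∈ Ioo (-δ) δ, (⨆ k, ρs k x) ≤ ρs n x + 1 / ((n : ℝ) + 1) / 2 :=
    fun n x hx => ciSup_le fun k => key k n x hx
  refine ⟨fun x => ⨆ k, ρs k x, ?_, fun x hx => (hnonneg 0 x hx).trans (hle 0 x hx),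
    densApprox_measure_eq hsum hdens (fun n => ?_) hnonneg hle hge⟩
  · -- continuity via uniform convergence on the window
    have htu : TendstoUniformlyOn (fun n => ρs n) (fun x => ⨆ k, ρs k x) atTop (Ioo (-δ) δ) := by
      rw [Metric.tendstoUniformlyOn_iff]
      intro e he
      have hev : ∀ᶠ n : ℕ in atTop, 1 / ((n : ℝ) + 1) < e :=
        (tendsto_one_div_add_atTop_nhds_zero_nat (𝕜 := ℝ)).eventually_lt_const he
      filter_upwards [hev] with n hn x hx
      rw [Real.dist_eq, abs_sub_lt_iff]
      constructor <;> linarith [hle n x hx, hge n x hx, hεpos n]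
    exact htu.continuousOn (Frequently.of_forall hcont)
  · -- slab mass of the whole window
    have h := hslab n 0 δ hδ
    rwa [zero_sub, zero_add] at h

end Summit.AtomisticToContinuum.FouriersLaw.Theorems.MourreDissolution
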